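import Mathlib.Topology.Algebra.Module.FiniteDimension
import Literature.Analysis.FluidPDE.OnsagerBDSVPerturbationSmooth
import Literature.Analysis.FunctionSpaces.FlatTorusProofs
import Literature.Analysis.FunctionSpaces.TorusCalculusProofs
import HarnessLib

/-!
# The BDSV perturbation: Mikado profiles on compact sets, and the lifted potential (§5.1, §5.3)

Buckmaster–De Lellis–Székelyhidi–Vicol (BDSV), *Onsager's conjecture for admissible weak
solutions*, CPAM 72 (2019) = arXiv:1701.08678. Two structural inputs of the perturbation
estimates Cor. 5.8 / Prop. 5.7 for the curl-form perturbation `w_{q+1} = n⁻¹ curl Z`,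
`Z = Σᵢ ρ_{q,i}^{1/2} ∇Φᵢᵀ V(R̃_{q,i}, n Φᵢ)` of `OnsagerBDSVPerturbation.lean`
(`BDSV.potential`):

* **Mikado profiles are bounded with all derivatives on compact sets of matrices** — the
  counterpart, for the smooth potential `V(R, ξ)` of a `BDSV.MikadoDatum`, of (5.7)
  `sup_{R ∈ 𝒩} |D_R^N a_k(R)| ≤ C(𝒩, N, m)|k|^{-m}` ("from the smoothness of `W`") and of
  Remark 5.2 / Lemma 5.5 (the geometric constant `M̄`): for the lift
  `BDSV.mikadoLift V (R, ξ) = V(R, proj ξ)` on `𝕄 × ℝ³`, smooth and `ℤ³`-periodic in `ξ`, and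
  every compact `K ⊆ 𝕄` and order `m`, `sup_{K × ℝ³} ‖Dᵐ(mikadoLift V)‖ < ∞`
  (`BDSV.exists_forall_norm_iteratedFDeriv_mikadoLift_le`; periodicity reduces `ξ` to the
  closed unit cube, where continuity and compactness apply);
* **the lift of the potential to `ℝ³` in closed form**: continuous (bi)linear wrappers
  `BDSV.jacCLM` (matrix of a linear map), `BDSV.ofColsCLM`, `BDSV.bmat A u = Aᵀu`, the lifted
  objects `BDSV.liftGradPhi`, `BDSV.liftTildeR`, `BDSV.liftSummand` (functions on `ℝ³` built from
  the lifts of `ηᵢ(t)`, `R̊̄_q(t)`, `Dᵢ(t)` and `mikadoLift V`), and the identities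
  `lift (∇Φᵢ(t)) = liftGradPhi`, `lift (R̃_{q,i}(t)) = liftTildeR`, and
  `lift (i-th summand of Z(t)) = liftSummand` (`BDSV.lift_potentialSummand`), with
  `BDSV.potential = Σᵢ BDSV.potentialSummand`. The derivative bounds of Prop. 5.7 / Cor. 5.8
  are then statements about smooth functions on `ℝ³` (sequel files).

## References

* T. Buckmaster, C. De Lellis, L. Székelyhidi Jr., V. Vicol, *Onsager's conjecture for admissible
  weak solutions*, Comm. Pure Appl. Math. 72 (2019) 229–274 = arXiv:1701.08678, §5.1 (5.7),
  Remark 5.2, §5.3 (5.28), Lemma 5.5, Def. 5.6, §5.5 Prop. 5.7, Cor. 5.8.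
-/

open MeasureTheory Set
open scoped NNReal ENNReal ContDiff Matrix Matrix.Norms.Elementwise

noncomputable section

namespace Literature.Analysis.FluidPDE

namespace BDSV

open FunctionSpaces FunctionSpaces.Torus

/-- The flat three-torus `T³ = (ℝ/ℤ)³`, local notation. -/
local notation "𝕋³" => UnitAddTorus (Fin 3)

/-- Euclidean `ℝ³`, local notation. -/
local notation "ℝ³" => EuclideanSpace ℝ (Fin 3)

/-- Real `3 × 3` matrices, local notation. -/
local notation "𝕄" => Matrix (Fin 3) (Fin 3) ℝ

/-! ## Mikado profiles lifted to `𝕄 × ℝ³`: periodicity and bounds on compact sets -/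

section MikadoLift

/-- The lift of a matrix-parametrised profile `V : 𝕄 → T³ → ℝ³` to `𝕄 × ℝ³`,
`(R, ξ) ↦ V(R, proj ξ)` (the function whose smoothness `BDSV.MikadoDatum.smooth_V` records).
[cite: BuckmasterEtAl2018, §5.1 (Lemma 5.1, (5.9))] -/
def mikadoLift (V : 𝕄 → 𝕋³ → ℝ³) : 𝕄 × ℝ³ → ℝ³ := fun p => V p.1 (proj p.2)

/-- `mikadoLift V (R, ξ) = V R (proj ξ)`. [folklore] -/
@[simp] theorem mikadoLift_apply (V : 𝕄 → 𝕋³ → ℝ³) (R : 𝕄) (ξ : ℝ³) :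
    mikadoLift V (R, ξ) = V R (proj ξ) := rfl

/-- The potential of a Mikado datum has a smooth lift. [folklore] -/
theorem MikadoDatum.contDiff_mikadoLift_V {r : ℝ} (𝔚 : MikadoDatum r) :
    ContDiff ℝ ∞ (mikadoLift 𝔚.V) := 𝔚.smooth_V

/-- The flows of a Mikado datum have a smooth lift. [folklore] -/
theorem MikadoDatum.contDiff_mikadoLift_W {r : ℝ} (𝔚 : MikadoDatum r) :
    ContDiff ℝ ∞ (mikadoLift 𝔚.W) := 𝔚.smooth_W

/-- The lift is `ℤ³`-periodic in `ξ`. [folklore] -/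
theorem mikadoLift_add_latticeVec (V : 𝕄 → 𝕋³ → ℝ³) (p : 𝕄 × ℝ³) (k : Fin 3 → ℤ) :
    mikadoLift V (p + (0, latticeVec k)) = mikadoLift V p := by
  obtain ⟨R, ξ⟩ := p
  simp only [Prod.mk_add_mk, add_zero, mikadoLift_apply, proj_add, proj_latticeVec]

/-- All derivatives of the lift are `ℤ³`-periodic in `ξ`. [folklore] -/
theorem iteratedFDeriv_mikadoLift_add_latticeVec (V : 𝕄 → 𝕋³ → ℝ³) (m : ℕ) (p : 𝕄 × ℝ³)
    (k : Fin 3 → ℤ) :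
    iteratedFDeriv ℝ m (mikadoLift V) (p + (0, latticeVec k)) = iteratedFDeriv ℝ m (mikadoLift V) p := by
  have h : (fun q => mikadoLift V (q + (0, latticeVec k))) = mikadoLift V :=
    funext fun q => mikadoLift_add_latticeVec V q k
  have := congrFun (iteratedFDeriv_comp_add_right' (𝕜 := ℝ) (f := mikadoLift V) m
    ((0 : 𝕄), latticeVec k)) p
  rw [h] at this
  exact this.symm

/-- **Derivatives of Mikado profiles are bounded on compact sets of matrices** (the role of
(5.7) / Remark 5.2 / Lemma 5.5: the constants of the perturbation estimates depend on the profile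
only through such suprema over the fixed compact neighbourhood `𝒩` of `Id`): for a smooth lift
and compact `K ⊆ 𝕄`, `sup_{R ∈ K, ξ ∈ ℝ³} ‖Dᵐ(mikadoLift V)(R, ξ)‖ ≤ C(K, m)` (periodicity in `ξ`
reduces to the compact set `K × [0,1]³`). [cite: BuckmasterEtAl2018, §5.1 (5.7) and Remark 5.2] -/
theorem exists_forall_norm_iteratedFDeriv_mikadoLift_le {V : 𝕄 → 𝕋³ → ℝ³}
    (hV : ContDiff ℝ ∞ (mikadoLift V)) {K : Set 𝕄} (hK : IsCompact K) (m : ℕ) :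
    ∃ C : ℝ, 0 ≤ C ∧ ∀ R ∈ K, ∀ ξ : ℝ³, ‖iteratedFDeriv ℝ m (mikadoLift V) (R, ξ)‖ ≤ C := by
  have hc : Continuous (iteratedFDeriv ℝ m (mikadoLift V)) :=
    hV.continuous_iteratedFDeriv (WithTop.coe_le_coe.2 le_top)
  obtain ⟨C, hC⟩ := (hK.prod (isCompact_toLp_image_pi_Icc (d := Fin 3))).exists_bound_of_continuousOn
    hc.continuousOn
  refine ⟨max C 0, le_max_right _ _, fun R hR ξ => ?_⟩
  obtain ⟨k, hk⟩ := exists_repr_proj_eq_add_latticeVec_holds ξ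
  have hξ : ((R, ξ) : 𝕄 × ℝ³) = ((R, repr (proj ξ)) : 𝕄 × ℝ³) + (0, latticeVec (-k)) := by
    have h0 : latticeVec k + latticeVec (-k) = (0 : ℝ³) := by
      rw [← latticeVec_add, add_neg_cancel, latticeVec_zero]
    ext1
    · simp
    · rw [Prod.snd_add, hk, add_assoc, h0, add_zero]
  rw [hξ, iteratedFDeriv_mikadoLift_add_latticeVec]
  exact (hC _ (mk_mem_prod hR (repr_mem_toLp_image_pi_Icc _))).trans (le_max_left _ _)

/-- Uniform bound for the derivatives of orders `≤ N` of a Mikado lift on `K × ℝ³`. [folklore] -/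
theorem exists_forall_le_norm_iteratedFDeriv_mikadoLift_le {V : 𝕄 → 𝕋³ → ℝ³}
    (hV : ContDiff ℝ ∞ (mikadoLift V)) {K : Set 𝕄} (hK : IsCompact K) (N : ℕ) :
    ∃ C : ℝ, 0 ≤ C ∧ ∀ m ≤ N, ∀ R ∈ K, ∀ ξ : ℝ³, ‖iteratedFDeriv ℝ m (mikadoLift V) (R, ξ)‖ ≤ C := by
  induction N with
  | zero =>
    obtain ⟨C, hC0, hC⟩ := exists_forall_norm_iteratedFDeriv_mikadoLift_le hV hK 0
    exact ⟨C, hC0, fun m hm => by rw [Nat.le_zero.1 hm]; exact hC⟩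
  | succ N ih =>
    obtain ⟨C, hC0, hC⟩ := ih
    obtain ⟨C', hC0', hC'⟩ := exists_forall_norm_iteratedFDeriv_mikadoLift_le hV hK (N + 1)
    refine ⟨max C C', le_max_of_le_left hC0, fun m hm R hR ξ => ?_⟩
    rcases Nat.lt_or_ge m (N + 1) with h | h
    · exact (hC m (Nat.lt_succ_iff.1 h) R hR ξ).trans (le_max_left _ _)
    · rw [le_antisymm hm h]
      exact (hC' R hR ξ).trans (le_max_right _ _)

end MikadoLift

/-! ## Linear-algebra wrappers as continuous (bi)linear maps -/

section LinearAlgebra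

variable {E₁ E₂ E₃ : Type*} [NormedAddCommGroup E₁] [NormedSpace ℝ E₁] [FiniteDimensional ℝ E₁]
  [NormedAddCommGroup E₂] [NormedSpace ℝ E₂] [FiniteDimensional ℝ E₂]
  [NormedAddCommGroup E₃] [NormedSpace ℝ E₃]

/-- A bilinear map between finite-dimensional real normed spaces as a continuous bilinear map
(all linear maps on finite-dimensional spaces are continuous). [folklore] -/
def bilinCLM (B : E₁ →ₗ[ℝ] E₂ →ₗ[ℝ] E₃) : E₁ →L[ℝ] E₂ →L[ℝ] E₃ :=
  LinearMap.toContinuousLinearMap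
    ((LinearMap.toContinuousLinearMap : (E₂ →ₗ[ℝ] E₃) ≃ₗ[ℝ] (E₂ →L[ℝ] E₃)).toLinearMap ∘ₗ B)

/-- `bilinCLM B x y = B x y`. [folklore] -/
@[simp] theorem bilinCLM_apply (B : E₁ →ₗ[ℝ] E₂ →ₗ[ℝ] E₃) (x : E₁) (y : E₂) :
    bilinCLM B x y = B x y := rfl

/-- The matrix of a linear map `ℝ³ → ℝ³` in the standard basis, `(jac L)_{ab} = (L e_b)_a`, as a
continuous linear map (so that `∇Φ = Id + jac(D(lift D))`, cf. `BDSV.gradPhi`). [folklore] -/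
def jacCLM : (ℝ³ →L[ℝ] ℝ³) →L[ℝ] 𝕄 :=
  LinearMap.toContinuousLinearMap
    { toFun := fun L => Matrix.of fun a b => L (EuclideanSpace.single b 1) a
      map_add' := fun L L' => by ext a b; simp
      map_smul' := fun c L => by ext a b; simp }

/-- Entries of `jacCLM L`. [folklore] -/
@[simp] theorem jacCLM_apply (L : ℝ³ →L[ℝ] ℝ³) (a b : Fin 3) :
    jacCLM L a b = L (EuclideanSpace.single b 1) a := rfl

/-- `BDSV.ofCols` as a continuous linear map. [folklore] -/
def ofColsCLM : (Fin 3 → ℝ³) →L[ℝ] 𝕄 :=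
  LinearMap.toContinuousLinearMap
    { toFun := ofCols
      map_add' := fun S S' => by ext a b; simp
      map_smul' := fun c S => by ext a b; simp }

/-- `ofColsCLM S = ofCols S`. [folklore] -/
@[simp] theorem ofColsCLM_apply (S : Fin 3 → ℝ³) : ofColsCLM S = ofCols S := rfl

/-- The bilinear action `(A, u) ↦ Aᵀ u` of `BDSV.potential` (`Matrix.toEuclideanLin Aᵀ u`), as a
continuous bilinear map. [folklore] -/
def bmat : 𝕄 →L[ℝ] ℝ³ →L[ℝ] ℝ³ :=
  bilinCLM (LinearMap.mk₂ ℝ (fun A u => Matrix.toEuclideanLin Aᵀ u)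
    (fun A A' u => by simp [Matrix.transpose_add, map_add])
    (fun c A u => by simp [Matrix.transpose_smul, map_smul])
    (fun A u u' => by simp [map_add])
    (fun c A u => by simp [map_smul]))

/-- `bmat A u = Aᵀ u`. [folklore] -/
@[simp] theorem bmat_apply (A : 𝕄) (u : ℝ³) : bmat A u = Matrix.toEuclideanLin Aᵀ u := rfl

/-- Matrix multiplication on `𝕄` as a continuous bilinear map (for the elementwise norm).
[folklore] -/
def mmul : 𝕄 →L[ℝ] 𝕄 →L[ℝ] 𝕄 := bilinCLM (LinearMap.mul ℝ 𝕄)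

/-- `mmul A B = A * B`. [folklore] -/
@[simp] theorem mmul_apply (A B : 𝕄) : mmul A B = A * B := rfl

/-- Transposition on `𝕄` as a continuous linear map. [folklore] -/
def mtranspose : 𝕄 →L[ℝ] 𝕄 :=
  LinearMap.toContinuousLinearMap (Matrix.transposeLinearEquiv (Fin 3) (Fin 3) ℝ ℝ).toLinearMap

/-- `mtranspose A = Aᵀ`. [folklore] -/
@[simp] theorem mtranspose_apply (A : 𝕄) : mtranspose A = Aᵀ := rfl

/-- Transposition preserves the elementwise sup norm. [folklore] -/
theorem norm_mtranspose_apply (A : 𝕄) : ‖mtranspose A‖ = ‖A‖ := by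
  rw [mtranspose_apply, Matrix.norm_transpose]

end LinearAlgebra

/-! ## The lifted objects of the construction and the lift identities -/

section Lifts

/-- The lift of `∇Φ = Id + ∇D` to `ℝ³`: `y ↦ Id + jac(D(lift D)(y))`, for a displacement slice
`D : T³ → ℝ³`. [cite: BuckmasterEtAl2018, §5.2 (Φ_i)] -/
def liftGradPhi (Dsl : 𝕋³ → ℝ³) (y : ℝ³) : 𝕄 := 1 + jacCLM (fderiv ℝ (lift Dsl) y)

/-- The lift of `R̃ = ∇Φ (Id - c R̊̄) ∇Φᵀ` to `ℝ³` (`c = Σ∫η_j²/ρ_q`), for slices `R̊̄ : T³ → (Fin 3 → ℝ³)`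
and `D`. [cite: BuckmasterEtAl2018, §5.5 (5.32)] -/
def liftTildeR (c : ℝ) (Rsl : 𝕋³ → Fin 3 → ℝ³) (Dsl : 𝕋³ → ℝ³) (y : ℝ³) : 𝕄 :=
  liftGradPhi Dsl y * (1 - c • ofColsCLM (lift Rsl y)) * (liftGradPhi Dsl y)ᵀ

/-- The lift to `ℝ³` of one summand `ρ_{q,i}^{1/2} ∇Φᵢᵀ V(R̃_{q,i}, n Φᵢ)` of the potential `Z`:
`y ↦ (σ η(proj y)) • (∇Φ(y))ᵀ V(R̃(y), proj (n (y + D(y))))`, with `σ = (ρ_q/Σ∫η_j²)^{1/2}`,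
`c = Σ∫η_j²/ρ_q` and real frequency `n`. [cite: BuckmasterEtAl2018, §5.3 (5.28)] -/
def liftSummand (V : 𝕄 → 𝕋³ → ℝ³) (σ c n : ℝ) (ηsl : 𝕋³ → ℝ) (Rsl : 𝕋³ → Fin 3 → ℝ³)
    (Dsl : 𝕋³ → ℝ³) (y : ℝ³) : ℝ³ :=
  (σ * lift ηsl y) • bmat (liftGradPhi Dsl y)
    (mikadoLift V (liftTildeR c Rsl Dsl y, n • (y + lift Dsl y)))

variable (P : Params) (S : Setting)

/-- The `i`-th summand `ρ_{q,i}^{1/2} ∇Φᵢᵀ V(R̃_{q,i}, n_{q+1} Φᵢ)` of the potential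
`Z = BDSV.potential` of (5.28). [cite: BuckmasterEtAl2018, §5.3 (5.28)] -/
def potentialSummand (𝔚 : MikadoDatum mikadoRadius) (η : ℕ → ℝ → 𝕋³ → ℝ) (D : ℕ → ℝ → 𝕋³ → ℝ³)
    (i : ℕ) (t : ℝ) (x : 𝕋³) : ℝ³ :=
  sqrtRhoI P S η i t x •
    Matrix.toEuclideanLin (gradPhi D i t x)ᵀ
      (𝔚.V (tildeR P S η D i t x) (P.freqNat (S.q + 1) • phiPoint D i t x))

/-- `Z = Σᵢ (i-th summand)`. [folklore] -/
theorem potential_eq_sum (𝔚 : MikadoDatum mikadoRadius) (η : ℕ → ℝ → 𝕋³ → ℝ)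
    (D : ℕ → ℝ → 𝕋³ → ℝ³) (t : ℝ) (x : 𝕋³) :
    potential P S 𝔚 η D t x =
      ∑ i ∈ Finset.range (cutoffCount S.T (P.τ S.q)), potentialSummand P S 𝔚 η D i t x := rfl

variable {P S}

/-- `lift (∇Φᵢ(t)) = liftGradPhi (Dᵢ t)` for a `C¹` displacement slice. [folklore] -/
theorem lift_gradPhi {D : ℕ → ℝ → 𝕋³ → ℝ³} {i : ℕ} {t : ℝ} (hD : IsContDiff 1 (D i t)) :
    lift (gradPhi D i t) = liftGradPhi (D i t) := by
  funext y
  rw [lift_apply, gradPhi, liftGradPhi]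
  congr 1
  ext a b
  rw [Matrix.of_apply, jacCLM_apply, partialDeriv_eq_fderiv_apply hD, fderiv_lift]

/-- `lift (R̃_{q,i}(t)) = liftTildeR (Σ∫η_j²/ρ_q) (R̊̄_q t) (Dᵢ t)` for a `C¹` displacement slice.
[folklore] -/
theorem lift_tildeR {η : ℕ → ℝ → 𝕋³ → ℝ} {D : ℕ → ℝ → 𝕋³ → ℝ³} {i : ℕ} {t : ℝ}
    (hD : IsContDiff 1 (D i t)) :
    lift (tildeR P S η D i t) = liftTildeR (etaMass P S η t / rhoQ P S t) (S.Rbar t) (D i t) := by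
  funext y
  have h := congrFun (lift_gradPhi (D := D) (i := i) (t := t) hD) y
  rw [lift_apply] at h
  rw [lift_apply, tildeR, liftTildeR, h, ofColsCLM_apply, lift_apply]

/-- **The lift of the potential summand in closed form**:
`lift (ρ_{q,i}^{1/2} ∇Φᵢᵀ V(R̃_{q,i}, n_{q+1}Φᵢ))(t) = liftSummand V σ c n (ηᵢ t) (R̊̄_q t) (Dᵢ t)`
with `σ = (ρ_q/Σ∫η_j²)^{1/2}`, `c = Σ∫η_j²/ρ_q`, `n = n_{q+1}` (using
`n • proj z = proj (n • z)` and `proj y + proj (D y) = proj (y + D y)`). [cite: BuckmasterEtAl2018, §5.3 (5.28)] -/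
theorem lift_potentialSummand {𝔚 : MikadoDatum mikadoRadius} {η : ℕ → ℝ → 𝕋³ → ℝ}
    {D : ℕ → ℝ → 𝕋³ → ℝ³} {i : ℕ} {t : ℝ} (hD : IsContDiff 1 (D i t)) :
    lift (potentialSummand P S 𝔚 η D i t) =
      liftSummand 𝔚.V (Real.sqrt (rhoQ P S t / etaMass P S η t)) (etaMass P S η t / rhoQ P S t)
        (P.freqNat (S.q + 1)) (η i t) (S.Rbar t) (D i t) := by
  funext y
  have hG := congrFun (lift_gradPhi (D := D) (i := i) (t := t) hD) y
  have hR := congrFun (lift_tildeR (P := P) (S := S) (η := η) (D := D) (i := i) (t := t) hD) y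
  rw [lift_apply] at hG hR
  rw [lift_apply, potentialSummand, liftSummand, bmat_apply, hG, hR, sqrtRhoI, lift_apply,
    mikadoLift_apply, phiPoint, lift_apply, mul_comm]
  congr 2
  rw [← proj_add, Nat.cast_smul_eq_nsmul, proj_nsmul]

end Lifts

end BDSV

end Literature.Analysis.FluidPDE
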